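import Literature.NumberTheory.ComplexMultiplication.TateHypEllPowerTowerOfCMRank
import Mathlib.CategoryTheory.Preadditive.Biproducts
import HarnessLib

/-!
# Tate's hypothesis along `ℓ`-power towers for powers of a CM abelian variety

Theorems only (topic `NumberTheory/ComplexMultiplication`; no definition, no named fact, no instance).
Sequel of `TateHypEllPowerTowerOfCMRank` (the carrier-free rank-`r` core) and
`TateHypEllPowerTowerOfCMElliptic` (rank one).

For an abelian variety `A₀` over a field `k` with a ring action `ι₀ : 𝓞_K → End A₀` such that
`T_ℓ A₀` is free of rank one over `ℤ_ℓ ⊗ 𝓞_K` (a `ℤ_ℓ`-basis `B_k = T_ℓ(ι₀ b_k) t₀` over an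
integral basis `(b_k)` of `𝓞_K` — e.g. any structure of CM type `(K, Φ)` over `k`,
`IsCMTypeRealisationOver.exists_basis_eq_tateModuleMap_apply`) and ONE element `σ₀ ∈ Γ_k` acting on
`T_ℓ A₀` as `T_ℓ(ι₀ π)` with `ℚ(π) = K`, **Tate's finiteness hypothesis along `ℓ`-power towers holds
for every power `A₀ʳ = ⨁_{Fin r} A₀`** (`tateHypEllPowerTower_biproduct_of_tateRep_eq`): along every
tower of isogenies `f n : B n → A₀ʳ`, `h n : A₀ʳ → B n`, `h n ∘ f n = ℓⁿ`, `f n ∘ h n = ℓⁿ` over a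
number field, infinitely many `B n` are mutually `k`-isomorphic.  In particular
(`tateHypEllPowerTower_pow_of_CM_elliptic_of_thm18_6`) this holds for every power of a CM ELLIPTIC
structure over a number field, granted [Shimura 1998, Thm. 18.6] (`shimura1998_thm18_6`, discharged
Summits-side) — Shimura–Taniyama at one degree-one place
(`exists_tateRep_eq_tateModuleMap_and_adjoin_eq_top`).

Proof: the matrix action `ιP(e) = biproduct.matrix (j m ↦ ι₀(e_{mj}))` of `M_r(𝓞_K)` on `A₀ʳ`
(built inside the proof, pattern of `AbelianVariety.intMatrixHom`), the decomposition
`T_ℓ(A₀ʳ) ≅ (T_ℓ A₀)ʳ` by `x ↦ (T_ℓ(π_i) x)_i` (`T_ℓ` is additive: `tateModuleMap_add/comp/id`,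
`biproduct.total`), the product basis `B_{i,k} = T_ℓ(ι_i) B_k = T_ℓ(ιP(b_k · 1)) t_i`, and the
scalar Frobenius `ρ(σ₀) = T_ℓ(ιP(π · 1))` on `T_ℓ(A₀ʳ)`; then
`tateHypEllPowerTower_of_matrixAction_of_tateRep_eq` (Steinitz splitting over `𝓞_K`, `Cl(K)`
finite, shapes, and the realising endomorphism, Tate 1966 §2).  No polarisation, no height, no
[Fal83] input: a decided instance-family of the re-keyed row VI-1 citation outside dimension one.

## References

* [Tate1966Endomorphisms] J. Tate, Invent. Math. 2 (1966), §2, pp. 136–137.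
* [Shimura1998] G. Shimura, *Abelian Varieties with Complex Multiplication and Modular Functions*
  (1998), §7.4 Props. 15, 17; §18.6 Thm. 18.6.
* [MumfordAV1970] D. Mumford, *Abelian Varieties* (1970), §19 (`T_ℓ` on homomorphisms, products).
-/

noncomputable section

open CategoryTheory CategoryTheory.Limits
open scoped NumberField Pointwise IntermediateField

namespace Literature.NumberTheory.ComplexMultiplication

open Literature.AlgebraicGeometry.Motives Literature.AlgebraicGeometry.Motives.AbelianVariety

/-- `T_ℓ` is additive on finite sums of homomorphisms. [folklore] -/
private theorem tateModuleMap_finset_sum {k : Type} [Field k] {A B : AbelianVariety k} (ℓ : ℕ)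
    [Fact ℓ.Prime] {I : Type*} (s : Finset I) (g : I → (A ⟶ B)) :
    tateModuleMap ℓ (∑ i ∈ s, g i) = ∑ i ∈ s, tateModuleMap ℓ (g i) := by
  classical
  induction s using Finset.induction_on with
  | empty => rw [Finset.sum_empty, Finset.sum_empty, tateModuleMap_zero]
  | insert i s hi ih => rw [Finset.sum_insert hi, Finset.sum_insert hi, tateModuleMap_add, ih]

/-- **Tate's hypothesis along `ℓ`-power towers for the powers `A₀ʳ` of an abelian variety with
`T_ℓ A₀` free of rank one over `ℤ_ℓ ⊗ 𝓞_K` and one scalar Frobenius generating `K`** (Tate 1966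
§2; Steinitz / Jordan–Zassenhaus over `𝓞_K`): if `ι₀ : 𝓞_K → End A₀`, `B_k = T_ℓ(ι₀ b_k) t₀` is a
`ℤ_ℓ`-basis of `T_ℓ A₀` over an integral basis `(b_k)`, and `σ₀ ∈ Γ_k` acts on `T_ℓ A₀` as
`T_ℓ(ι₀ π)` with `ℚ(π) = K`, then `AbelianVariety.tateHypEllPowerTower (⨁_{Fin r} A₀) ℓ`.
[cite: Tate1966Endomorphisms, §2 pp. 136–137] [cite: MumfordAV1970, §19] -/
theorem tateHypEllPowerTower_biproduct_of_tateRep_eq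
    {k : Type} [Field k] {K : Type*} [Field K] [NumberField K]
    (A₀ : AbelianVariety k) (ι₀ : 𝓞 K →+* End A₀) (ℓ : ℕ) [Fact ℓ.Prime]
    (t₀ : A₀.tateModule ℓ) {κ : Type*} [Fintype κ] (b : Module.Basis κ ℤ (𝓞 K))
    (Bas₀ : Module.Basis κ ℤ_[ℓ] (A₀.tateModule ℓ))
    (hBas₀ : ∀ k', Bas₀ k' = tateModuleMap ℓ (ι₀ (b k') : A₀ ⟶ A₀) t₀)
    (σ₀ : Field.absoluteGaloisGroup k) (π : 𝓞 K)
    (hσ₀ : A₀.tateRep ℓ σ₀ = tateModuleMap ℓ (ι₀ π : A₀ ⟶ A₀)) (hπ : ℚ⟮(π : K)⟯ = ⊤) (r : ℕ) :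
    (⨁ fun _ : Fin r => A₀).tateHypEllPowerTower ℓ := by
  classical
  set P : AbelianVariety k := ⨁ fun _ : Fin r => A₀ with hP
  intro hk Bt ft ht hft hht hhf hfh
  -- the matrix action `ιP(e) : (y_j) ↦ (∑_j e_{mj} y_j)_m`
  let mat : Matrix (Fin r) (Fin r) (𝓞 K) → (P ⟶ P) := fun e =>
    biproduct.matrix fun j m => (ι₀ (e m j) : A₀ ⟶ A₀)
  have hmat : ∀ e, mat e = biproduct.matrix fun j m => (ι₀ (e m j) : A₀ ⟶ A₀) := fun e => rfl
  have hcomp : ∀ (e : Matrix (Fin r) (Fin r) (𝓞 K)) (j m : Fin r),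
      biproduct.ι (fun _ : Fin r => A₀) j ≫ mat e ≫ biproduct.π (fun _ : Fin r => A₀) m =
        (ι₀ (e m j) : A₀ ⟶ A₀) := fun e j m => by
    rw [hmat, biproduct.ι_matrix_assoc, biproduct.lift_π]
  have hιπ : ∀ j m : Fin r, biproduct.ι (fun _ : Fin r => A₀) j ≫ biproduct.π (fun _ : Fin r => A₀) m =
      if j = m then 𝟙 A₀ else 0 := fun j m => by
    by_cases h : j = m
    · subst h; rw [biproduct.ι_π_self, if_pos rfl]
    · rw [biproduct.ι_π_ne _ h, if_neg h]
  have hext : ∀ {u v : P ⟶ P}, (∀ j m, biproduct.ι (fun _ : Fin r => A₀) j ≫ u ≫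
      biproduct.π (fun _ : Fin r => A₀) m = biproduct.ι (fun _ : Fin r => A₀) j ≫ v ≫
      biproduct.π (fun _ : Fin r => A₀) m) → u = v := fun {u v} huv => by
    apply biproduct.hom_ext'
    intro j
    apply biproduct.hom_ext
    intro m
    rw [Category.assoc, Category.assoc]
    exact huv j m
  have hmul : ∀ e e', mat (e * e') = mat e' ≫ mat e := fun e e' => by
    apply hext
    intro j m
    rw [hcomp, Category.assoc, hmat, hmat, biproduct.ι_matrix_assoc, biproduct.lift_matrix_assoc,
      biproduct.lift_π, Matrix.mul_apply, map_sum]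
    refine Finset.sum_congr rfl fun l _ => ?_
    rw [map_mul]
    rfl
  have hone : mat 1 = 𝟙 P := by
    apply hext
    intro j m
    rw [hcomp, Category.id_comp, hιπ, Matrix.one_apply]
    by_cases h : j = m
    · subst h; rw [if_pos rfl, if_pos rfl, map_one]; rfl
    · rw [if_neg (Ne.symm h), if_neg h, map_zero]; rfl
  have hadd : ∀ e e', mat (e + e') = mat e + mat e' := fun e e' => by
    apply hext
    intro j m
    rw [hcomp, Preadditive.add_comp, Preadditive.comp_add, hcomp, hcomp, Matrix.add_apply, map_add]
    rfl
  have hzero : mat 0 = 0 := by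
    apply hext
    intro j m
    rw [hcomp, Matrix.zero_apply, map_zero, Limits.zero_comp, Limits.comp_zero]
    rfl
  let ιP : Matrix (Fin r) (Fin r) (𝓞 K) →+* End P :=
    { toFun := mat
      map_one' := hone
      map_mul' := hmul
      map_zero' := hzero
      map_add' := hadd }
  have hιP : ∀ e, (ιP e : P ⟶ P) = mat e := fun e => rfl
  -- scalars act diagonally: `ι_i ≫ ιP(a • 1) = ι₀ a ≫ ι_i`
  have hscal : ∀ (a : 𝓞 K) (i : Fin r),
      biproduct.ι (fun _ : Fin r => A₀) i ≫ mat (a • 1) = (ι₀ a : A₀ ⟶ A₀) ≫ biproduct.ι (fun _ : Fin r => A₀) i :=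
    fun a i => by
    apply biproduct.hom_ext
    intro m
    rw [Category.assoc, hcomp, Category.assoc, hιπ, Matrix.smul_apply, Matrix.one_apply, smul_eq_mul]
    by_cases h : i = m
    · subst h; rw [if_pos rfl, if_pos rfl, mul_one, Category.comp_id]
    · rw [if_neg (Ne.symm h), if_neg h, mul_zero, map_zero, Limits.comp_zero]; rfl
  -- the Tate module of the biproduct: `x ↦ (T_ℓ(π_i) x)_i`
  let Tι : Fin r → (A₀.tateModule ℓ →ₗ[ℤ_[ℓ]] P.tateModule ℓ) := fun i =>
    tateModuleMap ℓ (biproduct.ι (fun _ : Fin r => A₀) i)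
  let Tπ : Fin r → (P.tateModule ℓ →ₗ[ℤ_[ℓ]] A₀.tateModule ℓ) := fun i =>
    tateModuleMap ℓ (biproduct.π (fun _ : Fin r => A₀) i)
  have hscalT : ∀ (a : 𝓞 K) (i : Fin r) (y : A₀.tateModule ℓ),
      tateModuleMap ℓ (mat (a • 1)) (Tι i y) = Tι i (tateModuleMap ℓ (ι₀ a : A₀ ⟶ A₀) y) :=
    fun a i y => by
    change tateModuleMap ℓ (mat (a • 1)) (tateModuleMap ℓ (biproduct.ι (fun _ : Fin r => A₀) i) y) =
      tateModuleMap ℓ (biproduct.ι (fun _ : Fin r => A₀) i) (tateModuleMap ℓ (ι₀ a : A₀ ⟶ A₀) y)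
    rw [← LinearMap.comp_apply, ← tateModuleMap_comp, hscal, tateModuleMap_comp, LinearMap.comp_apply]
  have hTπι : ∀ (j m : Fin r) (y : A₀.tateModule ℓ), Tπ m (Tι j y) = if j = m then y else 0 :=
    fun j m y => by
    change ((tateModuleMap ℓ (biproduct.π (fun _ : Fin r => A₀) m)).comp
      (tateModuleMap ℓ (biproduct.ι (fun _ : Fin r => A₀) j))) y = _
    rw [← tateModuleMap_comp, hιπ]
    by_cases h : j = m
    · subst h; rw [if_pos rfl, if_pos rfl, tateModuleMap_id, LinearMap.id_apply]
    · rw [if_neg h, if_neg h, tateModuleMap_zero, LinearMap.zero_apply]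
  have htotal : ∀ x : P.tateModule ℓ, ∑ i, Tι i (Tπ i x) = x := fun x => by
    have h1 : tateModuleMap ℓ (𝟙 P) x = x := by rw [tateModuleMap_id, LinearMap.id_apply]
    conv_rhs => rw [← h1, ← biproduct.total, tateModuleMap_finset_sum, LinearMap.sum_apply]
    refine Finset.sum_congr rfl fun i _ => ?_
    rw [tateModuleMap_comp, LinearMap.comp_apply]
  let φ : P.tateModule ℓ →ₗ[ℤ_[ℓ]] (Fin r → A₀.tateModule ℓ) := LinearMap.pi fun i => Tπ i
  let ψ : (Fin r → A₀.tateModule ℓ) →ₗ[ℤ_[ℓ]] P.tateModule ℓ :=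
    ∑ i, (Tι i).comp (LinearMap.proj i)
  have hφ : ∀ x i, φ x i = Tπ i x := fun x i => rfl
  have hψ : ∀ g, ψ g = ∑ i, Tι i (g i) := fun g => by
    simp only [ψ, LinearMap.sum_apply, LinearMap.comp_apply, LinearMap.proj_apply]
  have hψsingle : ∀ (i : Fin r) (y : A₀.tateModule ℓ), ψ (Pi.single i y) = Tι i y := fun i y => by
    rw [hψ, Finset.sum_eq_single i]
    · rw [Pi.single_eq_same]
    · intro j _ hj; rw [Pi.single_eq_of_ne hj, map_zero]
    · intro h; exact (h (Finset.mem_univ _)).elim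
  let Φ : P.tateModule ℓ ≃ₗ[ℤ_[ℓ]] (Fin r → A₀.tateModule ℓ) :=
    LinearEquiv.ofLinear φ ψ
      (by
        apply LinearMap.ext
        intro g
        funext m
        rw [LinearMap.comp_apply, hφ, hψ, map_sum, LinearMap.id_apply]
        simp_rw [hTπι]
        rw [Finset.sum_ite_eq' Finset.univ m g, if_pos (Finset.mem_univ _)])
      (by
        apply LinearMap.ext
        intro x
        rw [LinearMap.comp_apply, hψ, LinearMap.id_apply]
        exact htotal x)
  have hΦsymm : ∀ g, Φ.symm g = ψ g := fun g => rfl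
  -- the product basis and the base points
  let t : Fin r → P.tateModule ℓ := fun i => Tι i t₀
  let Bas : Module.Basis (Fin r × κ) ℤ_[ℓ] (P.tateModule ℓ) :=
    ((Pi.basis fun _ : Fin r => Bas₀).reindex (Equiv.sigmaEquivProd (Fin r) κ)).map Φ.symm
  have hBas : ∀ i k', Bas (i, k') = tateModuleMap ℓ (ιP (b k' • 1) : P ⟶ P) (t i) := fun i k' => by
    change Φ.symm (((Pi.basis fun _ : Fin r => Bas₀).reindex (Equiv.sigmaEquivProd (Fin r) κ)) (i, k')) = _
    rw [Module.Basis.reindex_apply, hΦsymm]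
    change ψ ((Pi.basis fun _ : Fin r => Bas₀) ⟨i, k'⟩) = _
    rw [Pi.basis_apply, hψsingle, hBas₀, hιP]
    change (Tι i) ((tateModuleMap ℓ (ι₀ (b k') : A₀ ⟶ A₀)) t₀) =
      (tateModuleMap ℓ (mat (b k' • 1))) ((tateModuleMap ℓ (biproduct.ι (fun _ : Fin r => A₀) i)) t₀)
    rw [← LinearMap.comp_apply, ← tateModuleMap_comp, ← LinearMap.comp_apply, ← tateModuleMap_comp,
      hscal]
  have hMt : ∀ (e : Matrix (Fin r) (Fin r) (𝓞 K)) (i : Fin r),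
      tateModuleMap ℓ (ιP e : P ⟶ P) (t i) =
        ∑ j, tateModuleMap ℓ (ιP (e j i • 1) : P ⟶ P) (t j) := fun e i => by
    simp only [hιP]
    change (tateModuleMap ℓ (mat e)) ((tateModuleMap ℓ (biproduct.ι (fun _ : Fin r => A₀) i)) t₀) =
      ∑ j, (tateModuleMap ℓ (mat (e j i • 1))) ((tateModuleMap ℓ (biproduct.ι (fun _ : Fin r => A₀) j)) t₀)
    rw [← LinearMap.comp_apply, ← tateModuleMap_comp, hmat e, biproduct.ι_matrix, biproduct.lift_eq,
      tateModuleMap_finset_sum, LinearMap.sum_apply]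
    refine Finset.sum_congr rfl fun j _ => ?_
    rw [← LinearMap.comp_apply, ← tateModuleMap_comp, hscal]
  -- the scalar Frobenius on `T_ℓ(A₀ʳ)`
  have hσP : P.tateRep ℓ σ₀ = tateModuleMap ℓ (ιP (π • 1) : P ⟶ P) := by
    apply LinearMap.ext
    intro x
    rw [hιP]
    conv_lhs => rw [← htotal x]
    conv_rhs => rw [← htotal x]
    rw [map_sum, map_sum]
    refine Finset.sum_congr rfl fun i _ => ?_
    rw [hscalT, ← hσ₀]
    exact (tateModuleMap_smul (biproduct.ι (fun _ : Fin r => A₀) i) σ₀ (Tπ i x)).symm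
  exact tateHypEllPowerTower_of_matrixAction_of_tateRep_eq P ιP ℓ t b Bas hBas hMt σ₀ π hσP hπ
    Bt ft ht hft hht hhf hfh

/-- **Tate's hypothesis along `ℓ`-power towers for the powers of a CM structure with one scalar
Frobenius generating `K`**: for `(A₀, ι₀)` of CM type `(K, Φ)` over `k`
(`IsCMTypeRealisationOver`: `T_ℓ A₀` is free of rank one over `ℤ_ℓ ⊗ 𝓞_K`) and `σ₀ ∈ Γ_k` acting
on `T_ℓ A₀` as `T_ℓ(ι₀ π)` with `ℚ(π) = K`, every power `⨁_{Fin r} A₀` satisfies Tate's hypothesis.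
[cite: Tate1966Endomorphisms, §2 pp. 136–137] [cite: Shimura1998, §7.4 Propositions 15 and 17] -/
theorem tateHypEllPowerTower_biproduct_of_isCMTypeRealisationOver_of_tateRep_eq
    {k : Type} [Field k] [Algebra k ℂ] {K : Type} [Field K] [NumberField K]
    [NumberField.IsCMField K] (Φ : CMType K) (A₀ : AbelianVariety k) (ι₀ : 𝓞 K →+* End A₀)
    (hA : IsCMTypeRealisationOver Φ A₀ ι₀) (ℓ : ℕ) [Fact ℓ.Prime]
    (σ₀ : Field.absoluteGaloisGroup k) (π : 𝓞 K)
    (hσ₀ : A₀.tateRep ℓ σ₀ = tateModuleMap ℓ (ι₀ π : A₀ ⟶ A₀)) (hπ : ℚ⟮(π : K)⟯ = ⊤) (r : ℕ) :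
    (⨁ fun _ : Fin r => A₀).tateHypEllPowerTower ℓ := by
  intro hk B f h hf hh hhf hfh
  obtain ⟨t₀, Bas₀, hBas₀⟩ := hA.exists_basis_eq_tateModuleMap_apply ℓ
  exact tateHypEllPowerTower_biproduct_of_tateRep_eq A₀ ι₀ ℓ t₀ (NumberField.RingOfIntegers.basis K)
    Bas₀ hBas₀ σ₀ π hσ₀ hπ r B f h hf hh hhf hfh

/-- **Tate's hypothesis along `ℓ`-power towers for every POWER of a CM elliptic structure over a
number field**, granted [Shimura 1998, Thm. 18.6] (`shimura1998_thm18_6`, the one printed input of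
the tree's Shimura–Taniyama theorem at good places): for `(A₀, ι₀)` of CM type `(K, Φ)` over `k`
with `[K : ℚ] = 2`, every `r` and every prime `ℓ`, along every `ℓ`-power isogeny tower onto
`⨁_{Fin r} A₀` infinitely many members are mutually `k`-isomorphic — the rank-`r` sequel of
`tateHypEllPowerTower_of_CM_elliptic_of_thm18_6`; no polarisation, no height, no [Fal83] input.
[cite: Tate1966Endomorphisms, §2 pp. 136–137] [cite: Shimura1998, §7.4 Propositions 15 and 17; §18.6 Theorem 18.6] -/
theorem tateHypEllPowerTower_pow_of_CM_elliptic_of_thm18_6 (h186 : shimura1998_thm18_6) :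
    ∀ {k : Type} [Field k] [Algebra k ℂ] {K : Type} [Field K] [NumberField K]
      [NumberField.IsCMField K] (Φ : CMType K) (A₀ : AbelianVariety k) (ι₀ : 𝓞 K →+* End A₀),
      IsCMTypeRealisationOver Φ A₀ ι₀ → Module.finrank ℚ K = 2 →
      ∀ (r ℓ : ℕ) [Fact ℓ.Prime], (⨁ fun _ : Fin r => A₀).tateHypEllPowerTower ℓ := by
  intro k _ _ K _ _ _ Φ A₀ ι₀ hA h2 r ℓ _ _ B f h hf hh hhf hfh
  obtain ⟨σ₀, π, hσ₀, hπ⟩ := exists_tateRep_eq_tateModuleMap_and_adjoin_eq_top h186 Φ A₀ ι₀ hA h2 ℓ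
  exact tateHypEllPowerTower_biproduct_of_isCMTypeRealisationOver_of_tateRep_eq Φ A₀ ι₀ hA ℓ σ₀ π
    hσ₀ hπ r B f h hf hh hhf hfh

end Literature.NumberTheory.ComplexMultiplication

end
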